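import Mathlib
import Summits.Ventures.HodgeRepro.Tier4.Common.KTypeSpace
import Summits.Ventures.HodgeRepro.Tier4.Common.SettingOfData
import Summits.Ventures.HodgeRepro.Tier4.Line1.SpectralOfRTF
import Summits.Ventures.HodgeRepro.Tier4.Line1.IrreducibleSubspace
import Summits.Ventures.HodgeRepro.Tier4.Line1.KernelNondegenerate
import Summits.Ventures.HodgeRepro.Tier4.Line1.LocallyCompactGA
import Summits.Ventures.HodgeRepro.Tier4.Line1.SecondCountableGA
import Summits.Ventures.HodgeRepro.Tier4.Line1.L2InfiniteGA
import Summits.Ventures.HodgeRepro.Tier4.Line1.MaximalFamily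
import Summits.Ventures.HodgeRepro.Tier4.Line4.W4SpectralBridge
import Summits.Ventures.HodgeRepro.Tier4.Line4.W3Reduction
import Summits.Ventures.HodgeRepro.Tier4.Line4.W3Reduction2
import Summits.Ventures.HodgeRepro.Tier4.Line4.W3ReductionGeneric
import Summits.Ventures.HodgeRepro.Tier4.Line4.AdaptedONBAdapted3
import Summits.Ventures.HodgeRepro.Tier4.Line4.AdaptedONBConj
import Summits.Ventures.HodgeRepro.Tier4.Line4.ConjSpanLemmas

/-!
# Tier4/Line4/W3OfAdaptedGeneric — the wall W3″ of LINE L4 from BASIS-FREE per-constituent data, GENERIC in the space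
that carries the Riesz vector (F-L4-JOINT: the joint `kTypeSpace` or a one-torus Riesz space), finiteness on the
irreducible constituents only

Blind re-derivation cell `pub-hodge-repro`, Tier 4 «prove the step» (README §9–§10), seat t4-L4-p1 (prover, LINE L4,
gen 3; cut of record S13520; findings S13578 (2), S13597 (2)).  Tree path
`lean/Summits/Ventures/HodgeRepro/Tier4/Line4/W3OfAdaptedGeneric.lean`.  Over a GENERIC plane `W` on typer-2's
`Setting.ofAdelicData` (the skeleton instantiates `W := seesawPlane …`, `w₀ := w₀ d`).

WHAT IS PROVED.  `mixed_two_torus_W3_of_adapted_generic`: `W3OfAdapted2.mixed_two_torus_W3_of_adapted'` (p683525) with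
typer-2's joint `kTypeSpace … K V` replaced by an arbitrary assignment `Sp K V ≤ V` (`hSp_le`) of a «Riesz space at the
level `K`» — the joint `kTypeSpace` as landed, or the one-torus Riesz space that F-L4-JOINT (L4-p2 g3 S13737 /
S13756; O-L4-JOINT crit-1 g5 S13773) calls for: the conjugate blocks of the adapted ONB span `Sp K (conj '' τ m)`
instead, and L1-p5's reduction is consumed in its generic form (`W3ReductionGeneric`).  The six basis-free clauses
are the same, all on `Sp`: `hfin` (finite-dimensional `Sp K (span U)` on the non-zero irreducible constituents),
`ha`/`hb` (one scalar per constituent on the conjugate of `Sp K (span U)`), `hvan` (within-constituent vanishing),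
`hadm` (the hit constituents are admissible), `hJ`.  The repaired space is instantiated in one line once chosen.
Nothing of the wall's content is proved.

Nothing here says anything about the status of the Hodge conjecture for CM abelian varieties, which is NOT proved
(HC_CM is NOT proved by anyone in this repository).
-/

set_option autoImplicit false

noncomputable section

namespace Summit.Ventures.HodgeRepro.Tier4.Line4

open Summit.Ventures.HodgeRepro.Tier4.Common Summit.Ventures.HodgeRepro.Tier4.Line1 MeasureTheory NumberField
open scoped ComplexConjugate

section Constituents

variable {k : Type} [Field k] [NumberField k] (W : PlaneData k) [MeasurableSpace (GA W)] [BorelSpace (GA W)]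
  (R : RTFData W) (μ : Measure (GA W)) [μ.IsHaarMeasure] [R.μT.IsHaarMeasure] [R.μT'.IsHaarMeasure]
  (DG : Set (GA W)) (fdG : IsFundamentalDomain (rationalPoints W) DG μ) (compG : IsCompact (closure DG))
  (compT : IsCompact (closure R.DT)) (compT' : IsCompact (closure R.DT'))

/-- **W3″-TYPE CONCLUSION FROM BASIS-FREE PER-CONSTITUENT DATA, GENERIC IN THE RIESZ SPACE `Sp`** (`Sp K V ≤ V`):
quantified over the non-zero irreducible invariant subspaces `U` of the setting (the constituents; the ONB's
constituent is `conj '' U`): (a) `hfin` — every non-zero irreducible constituent has a finite-dimensional Riesz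
space `Sp K (span U)` at the level `K`; (b) `ha`/`hb` — `R(f̄₁)`, `R(f₂ˇ)` act by a scalar on the conjugate of the `K`-type space of every
constituent, `hvan` — `R(f̄₁)` kills the conjugate of every vector of a constituent orthogonal to its `K`-type space,
`hadm` — a constituent on whose `K`-type space `R(f̄₁)` acts by a non-zero scalar is admissible; (c) `Jc(f₁ ⋆ f₂) ≠ 0`.
Then some admissible `V₀` carries, on its `K`-type space, a Riesz vector of the `T′`-period with a non-zero
`T`-period — the conclusion of the wall `mixed_two_torus_W3` verbatim over a generic plane. -/
theorem mixed_two_torus_W3_of_adapted_generic (Sp : Subgroup (GA W) → Submodule ℂ (GA W → ℂ) → Submodule ℂ (GA W → ℂ))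
    (hSp_le : ∀ (K : Subgroup (GA W)) (V : Submodule ℂ (GA W → ℂ)), Sp K V ≤ V)
    (hc : Continuous R.chi) (hu : ∀ a, ‖R.chi a‖ = 1)
    (hc' : Continuous R.chi') (hunit' : ∀ t, ‖R.chi' t‖ = 1)
    (q : QuadData k) (g g' : Matrix (Fin 4) (Fin 4) k) (w₀ : InfinitePlace k)
    (eP eM eP' eM' : InfinitePlace k → ℤ)
    (K : Subgroup (GA W)) (hK : IsCompactOpenIn W (finitePart W) K)
    (hfin : ∀ U : Set (GA W → ℂ), (Setting.ofAdelicData W R μ DG fdG compG compT compT').IsIrrNonzero U →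
      FiniteDimensional ℂ (Sp K (Submodule.span ℂ U)))
    {f₁ f₂ : GA W → ℂ} (h₁ : IsTestFn W f₁) (h₂ : IsTestFn W f₂)
    (ha : ∀ U : Set (GA W → ℂ), (Setting.ofAdelicData W R μ DG fdG compG compT compT').IsIrrNonzero U →
      ∃ a : ℂ, ∀ ψ ∈ Sp K (Submodule.span ℂ U),
        rightRegular W μ (RTF.cj f₁) (fun x => conj (ψ x)) = fun x => a * conj (ψ x))
    (hb : ∀ U : Set (GA W → ℂ), (Setting.ofAdelicData W R μ DG fdG compG compT compT').IsIrrNonzero U →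
      ∃ b : ℂ, ∀ ψ ∈ Sp K (Submodule.span ℂ U),
        rightRegular W μ (RTF.refl f₂) (fun x => conj (ψ x)) = fun x => b * conj (ψ x))
    (hvan : ∀ U : Set (GA W → ℂ), (Setting.ofAdelicData W R μ DG fdG compG compT compT').IsIrrNonzero U →
      ∀ ψ ∈ U, (∀ w ∈ Sp K (Submodule.span ℂ U),
        (Setting.ofAdelicData W R μ DG fdG compG compT compT').inner ψ w = 0) →
        rightRegular W μ (RTF.cj f₁) (fun x => conj (ψ x)) = fun _ => 0)
    (hadm : ∀ U : Set (GA W → ℂ), (Setting.ofAdelicData W R μ DG fdG compG compT compT').IsIrrNonzero U →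
      ∀ a : ℂ, a ≠ 0 →
      (∃ ψ ∈ Sp K (Submodule.span ℂ U), ψ ≠ 0 ∧
        rightRegular W μ (RTF.cj f₁) (fun x => conj (ψ x)) = fun x => a * conj (ψ x)) →
      IsAdmissibleS W (Setting.ofAdelicData W R μ DG fdG compG compT compT') q g g' w₀ eP eM eP' eM'
        (Submodule.span ℂ U))
    (hJ : R.Jc ((Setting.ofAdelicData W R μ DG fdG compG compT compT').conv f₁ f₂) ≠ 0) :
    ∃ V₀ : Submodule ℂ (GA W → ℂ),
      IsAdmissibleS W (Setting.ofAdelicData W R μ DG fdG compG compT compT') q g g' w₀ eP eM eP' eM' V₀ ∧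
      ∃ K₀ : Subgroup (GA W), IsCompactOpenIn W (finitePart W) K₀ ∧
        FiniteDimensional ℂ (Sp K₀ V₀) ∧
        ∃ f : GA W → ℂ, IsRieszVectorOn R μ DG (Sp K₀ V₀) f ∧
          periodLin W R.μT R.DT R.chi (restrictTo W (torusT W) f) ≠ 0 := by
  classical
  set S := Setting.ofAdelicData W R μ DG fdG compG compT compT' with hS
  haveI := locallyCompact_GA W
  haveI := secondCountable_GA W
  -- the functorial `(τ,K)`-part of a constituent: the conjugate of the `K`-type space of its conjugate
  let Wk : Set (GA W → ℂ) → Submodule ℂ (GA W → ℂ) := fun V =>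
    Sp K (Submodule.span ℂ ((fun ψ : GA W → ℂ => fun x => conj (ψ x)) '' V))
  let Wfd : Set (GA W → ℂ) → Submodule ℂ (GA W → ℂ) := fun V =>
    Submodule.span ℂ ((fun ψ : GA W → ℂ => fun x => conj (ψ x)) '' (Wk V : Set (GA W → ℂ)))
  have hW : ∀ V : Set (GA W → ℂ), S.IsInvariantSubspace V → S.IsIrreducible V → (0 : GA W → ℂ) ∈ V →
      (Wfd V : Set (GA W → ℂ)) ⊆ V ∧ FiniteDimensional ℂ (Wfd V) := by
    intro V hV hVirr h0
    have hVc : S.IsInvariantSubspace ((fun ψ : GA W → ℂ => fun x => conj (ψ x)) '' V) :=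
      isInvariantSubspace_conj S hV
    have hVne : V.Nonempty := ⟨0, h0⟩
    have hspanV : (Submodule.span ℂ V : Set (GA W → ℂ)) = V := coe_span_eq_of_isInvariantSubspace S hV hVne
    have hspanVc : (Submodule.span ℂ ((fun ψ : GA W → ℂ => fun x => conj (ψ x)) '' V) : Set (GA W → ℂ)) =
        (fun ψ : GA W → ℂ => fun x => conj (ψ x)) '' V :=
      coe_span_eq_of_isInvariantSubspace S hVc (hVne.image _)
    refine ⟨?_, ?_⟩
    · have hsub : (fun ψ : GA W → ℂ => fun x => conj (ψ x)) '' (Wk V : Set (GA W → ℂ)) ⊆ V := by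
        rintro _ ⟨w, hw, rfl⟩
        have hw' : w ∈ (fun ψ : GA W → ℂ => fun x => conj (ψ x)) '' V := by
          rw [← hspanVc]
          exact hSp_le K _ hw
        obtain ⟨v, hv, rfl⟩ := hw'
        show (fun x => conj (conj (v x))) ∈ V
        have e : (fun x => conj (conj (v x))) = v := by
          funext x
          simp
        rw [e]
        exact hv
      intro u hu
      rw [← hspanV]
      exact Submodule.span_mono hsub hu
    · -- finiteness: either `V` is a non-zero constituent (Harish-Chandra, `hfin`) or `V ⊆ {0}`
      by_cases hne : ∃ ψ ∈ V, ∃ x, ψ x ≠ 0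
      · haveI : FiniteDimensional ℂ (Wk V) := hfin _ (isIrrNonzero_conj S ⟨hV, hVirr, hne⟩)
        exact finiteDimensional_span_conj_image (Wk V)
      · have hVzero : V = {0} := by
          apply Set.Subset.antisymm
          · intro ψ hψ
            rw [Set.mem_singleton_iff]
            funext x
            by_contra hx
            exact hne ⟨ψ, hψ, x, hx⟩
          · intro ψ hψ
            rw [Set.mem_singleton_iff] at hψ
            rw [hψ]
            exact h0
        have hWk : Wk V = ⊥ := by
          apply le_bot_iff.1
          refine (hSp_le K _).trans ?_
          rw [Submodule.span_le]
          rintro _ ⟨ψ, hψ, rfl⟩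
          rw [hVzero, Set.mem_singleton_iff] at hψ
          rw [hψ]
          simp only [SetLike.mem_coe, Submodule.mem_bot]
          funext x
          simp
        have : Wfd V = ⊥ := by
          show Submodule.span ℂ ((fun ψ : GA W → ℂ => fun x => conj (ψ x)) '' (Wk V : Set (GA W → ℂ))) = ⊥
          rw [hWk, Submodule.span_eq_bot]
          rintro _ ⟨ψ, hψ, rfl⟩
          rw [SetLike.mem_coe, Submodule.mem_bot] at hψ
          rw [hψ]
          funext x
          simp
        rw [this]
        infer_instance
  -- the adapted ONB with a `(τ,K)`-block in every constituent
  obtain ⟨τ, φ, n, hB, F, -, hF, hspan⟩ := exists_adaptedONB_adapted'' S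
    (not_finiteDimensional_L2_DG W μ fdG compG)
    (fun V' hV' hcl hne' => S.exists_irreducible_invariant_subspace_of_nondegenerate V' hV' hcl hne'
      S.kernelOp_nondegenerate) Wfd hW
  -- the constituents of the reduction: the conjugates of the ONB's constituents
  let Vm : ℕ → Submodule ℂ (GA W → ℂ) := fun m =>
    Submodule.span ℂ ((fun ψ : GA W → ℂ => fun x => conj (ψ x)) '' τ m)
  have hWkV : ∀ m, Wk (τ m) = Sp K (Vm m) := fun m => rfl
  -- the conjugate blocks span the `K`-type spaces
  have hspan' : ∀ m, Submodule.span ℂ ((fun j => fun x => conj (φ j x)) '' (F m : Set ℕ)) =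
      Sp K (Vm m) := by
    intro m
    have e1 : (fun j => fun x => conj (φ j x)) '' (F m : Set ℕ) =
        (fun ψ : GA W → ℂ => fun x => conj (ψ x)) '' (φ '' (F m : Set ℕ)) := by
      rw [Set.image_image]
    rw [e1, ← span_conj_image_span, hspan m]
    show Submodule.span ℂ ((fun ψ : GA W → ℂ => fun x => conj (ψ x)) '' (Wfd (τ m) : Set (GA W → ℂ))) = _
    rw [span_conj_image_span, conj_image_conj_image, Submodule.span_eq]
  -- basis vectors are non-zero and continuous; a block-carrying constituent is non-zero
  have hφc : ∀ j, Continuous (φ j) := fun j => (hB.inv (n j)).cont _ (hB.mem j)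
  have hφcc : ∀ j, Continuous (fun x => conj (φ j x)) := fun j => Complex.continuous_conj.comp (hφc j)
  have hφne : ∀ j, φ j ≠ 0 := by
    intro j h
    have h1 := hB.orth j j
    rw [if_pos rfl, h, S.inner_fun_zero_left] at h1
    exact zero_ne_one h1
  have hτne : ∀ j, S.IsIrrNonzero (τ (n j)) := by
    intro j
    refine ⟨hB.inv (n j), hB.irred (n j), φ j, hB.mem j, ?_⟩
    obtain ⟨x, hx⟩ := Function.ne_iff.1 (hφne j)
    exact ⟨x, hx⟩
  have hUne : ∀ j, S.IsIrrNonzero ((fun ψ : GA W → ℂ => fun x => conj (ψ x)) '' τ (n j)) :=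
    fun j => isIrrNonzero_conj S (hτne j)
  -- the conjugate of a block vector lies in the `K`-type space of the constituent
  have hmemK : ∀ m, ∀ j ∈ F m, (fun x => conj (φ j x)) ∈ Sp K (Vm m) := by
    intro m j hj
    rw [← hspan' m]
    exact Submodule.subset_span ⟨j, Finset.mem_coe.2 hj, rfl⟩
  -- the per-constituent scalars
  let a' : ℕ → ℂ := fun m =>
    if h : S.IsIrrNonzero ((fun ψ : GA W → ℂ => fun x => conj (ψ x)) '' τ m) ∧ (F m).Nonempty then
      Classical.choose (ha _ h.1) else 0
  let b' : ℕ → ℂ := fun m =>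
    if h : S.IsIrrNonzero ((fun ψ : GA W → ℂ => fun x => conj (ψ x)) '' τ m) ∧ (F m).Nonempty then
      Classical.choose (hb _ h.1) else 0
  have ha'_spec : ∀ m, (h : S.IsIrrNonzero ((fun ψ : GA W → ℂ => fun x => conj (ψ x)) '' τ m) ∧ (F m).Nonempty) →
      ∀ ψ ∈ Sp K (Vm m),
        rightRegular W μ (RTF.cj f₁) (fun x => conj (ψ x)) = fun x => a' m * conj (ψ x) := by
    intro m h ψ hψ
    have e : a' m = Classical.choose (ha _ h.1) := by simp only [a', dif_pos h]
    rw [e]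
    exact Classical.choose_spec (ha _ h.1) ψ hψ
  have hb'_spec : ∀ m, (h : S.IsIrrNonzero ((fun ψ : GA W → ℂ => fun x => conj (ψ x)) '' τ m) ∧ (F m).Nonempty) →
      ∀ ψ ∈ Sp K (Vm m),
        rightRegular W μ (RTF.refl f₂) (fun x => conj (ψ x)) = fun x => b' m * conj (ψ x) := by
    intro m h ψ hψ
    have e : b' m = Classical.choose (hb _ h.1) := by simp only [b', dif_pos h]
    rw [e]
    exact Classical.choose_spec (hb _ h.1) ψ hψ
  have ha'_zero : ∀ m, ¬ (S.IsIrrNonzero ((fun ψ : GA W → ℂ => fun x => conj (ψ x)) '' τ m) ∧ (F m).Nonempty) →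
      a' m = 0 := by
    intro m h
    simp only [a', dif_neg h]
  have hconjconj : ∀ ψ : GA W → ℂ, (fun x => conj (conj (ψ x))) = ψ := by
    intro ψ
    funext x
    simp
  -- the eigen-relations on the blocks
  have ha' : ∀ m, ∀ j ∈ F m, rightRegular W μ (RTF.cj f₁) (φ j) = fun x => a' m * φ j x := by
    intro m j hj
    have hm : n j = m := hF m j hj
    have hU : S.IsIrrNonzero ((fun ψ : GA W → ℂ => fun x => conj (ψ x)) '' τ m) := hm ▸ hUne j
    have := ha'_spec m ⟨hU, ⟨j, hj⟩⟩ _ (hmemK m j hj)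
    simp only [Complex.conj_conj] at this
    exact this
  have hb' : ∀ m, ∀ j ∈ F m, rightRegular W μ (RTF.refl f₂) (φ j) = fun x => b' m * φ j x := by
    intro m j hj
    have hm : n j = m := hF m j hj
    have hU : S.IsIrrNonzero ((fun ψ : GA W → ℂ => fun x => conj (ψ x)) '' τ m) := hm ▸ hUne j
    have := hb'_spec m ⟨hU, ⟨j, hj⟩⟩ _ (hmemK m j hj)
    simp only [Complex.conj_conj] at this
    exact this
  -- admissibility of the constituents carrying a non-zero scalar on a non-empty block
  have hadm' : ∀ m, a' m ≠ 0 → IsAdmissibleS W S q g g' w₀ eP eM eP' eM' (Vm m) := by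
    intro m hane
    have hcond : S.IsIrrNonzero ((fun ψ : GA W → ℂ => fun x => conj (ψ x)) '' τ m) ∧ (F m).Nonempty := by
      by_contra h
      exact hane (ha'_zero m h)
    obtain ⟨j, hj⟩ := hcond.2
    have hm : n j = m := hF m j hj
    have hU : S.IsIrrNonzero ((fun ψ : GA W → ℂ => fun x => conj (ψ x)) '' τ m) := hm ▸ hUne j
    refine hadm _ hU (a' m) hane ⟨fun x => conj (φ j x), hmemK m j hj, ?_, ?_⟩
    · intro h
      apply hφne j
      funext x
      have hx := congrFun h x
      simp only [Pi.zero_apply] at hx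
      exact (map_eq_zero (starRingEnd ℂ)).1 hx
    · simp only [Complex.conj_conj]
      exact ha' m j hj
  -- the vanishing within each constituent
  have hvan' : ∀ j, j ∉ F (n j) → rightRegular W μ (RTF.cj f₁) (φ j) = fun _ => 0 := by
    intro j hj
    have hU := hUne j
    have hψ : (fun x => conj (φ j x)) ∈ (fun ψ : GA W → ℂ => fun x => conj (ψ x)) '' τ (n j) :=
      ⟨φ j, hB.mem j, rfl⟩
    have key : ∀ w ∈ Sp K (Vm (n j)), S.inner (fun x => conj (φ j x)) w = 0 := by
      intro w hw
      rw [← hspan' (n j)] at hw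
      obtain ⟨hwc, hwo⟩ := inner_eq_zero_of_mem_span_conjBlock W R μ DG fdG compG compT compT' hB (F (n j)) hj hw
      rw [S.inner_conj (S.memLp_restrict_of_continuous hwc) (S.memLp_restrict_of_continuous (hφcc j)), hwo,
        map_zero]
    have := hvan _ hU _ hψ key
    simp only [Complex.conj_conj] at this
    exact this
  exact mixed_two_torus_W3_of_spectral_data_generic W R μ DG fdG compG compT compT' Sp hc hu hc' hunit' q g g' w₀
    eP eM eP' eM' Vm K hK hB F hF hspan' h₁ h₂ a' b' hadm' ha' hb' hvan' hJ

end Constituents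

end Summit.Ventures.HodgeRepro.Tier4.Line4

end
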